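import Literature.NumberTheory.Weil1964.AdelicMetaplecticFinRep
import HarnessLib

/-!
# The finite factor `ω_f` of a CONJUGATED splitting: `ω_f(q s q⁻¹) = Q_f ∘ ω_f(s) ∘ Q_f⁻¹` when `ω(q) = A ⊗ Q_f`

Topic `NumberTheory/Weil1964`; namespace `Literature.NumberTheory.Weil1964`.  THEOREMS ONLY (no definition, no named fact, no
instance, no `sorry`).  Cell `hodgecm-mathlib`, (β)-glue of `A-plan/GS6-HOIST-SPEC.md` §9, piece (T5b) of node (T) «frame independence of
`ω(μ,ε,χ)»» (A-p02 (g10) `CENSUS-f1-frame` §4); sibling of ★/HOME `AdelicMetaplecticFinRepReindex` ((f1-up)(a)).  Books 0: nothing here is a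
named fact or moves a binder of HC_CM.

SETTING ([Weil1964] Chap. III n° 37–38, n° 40; [GelbartRogawski1991] §3.1 pp. 454–455).  A number field `F`, an invertible adelic Gram matrix
`T ∈ M_ι(𝔸_F)`, the metaplectic group of record `Mp_ψ(W_T)ᶜᵒⁿᵗ = adelicMpCont F ι T` with its Weil representation `ω = adelicMpCont.omega` on
`𝒮(𝔸_F^ι) = 𝓢((F ⊗ ℝ)^ι) ⊗ 𝒮((𝔸_F^∞)^ι)` and symplectic projection `π = adelicMpCont.proj`, a homomorphism `s : H →* Mp_ψ(W_T)ᶜᵒⁿᵗ` whose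
symplectic components fix the archimedean vectors (`harch`, so that ★ `finRepMp hT s harch`, `ω(s h) = 1 ⊗ ω_f(s h)`, is defined), and an
element `q ∈ Mp_ψ(W_T)ᶜᵒⁿᵗ` whose Weil operator is a PURE TENSOR on pure tensors:
`ω(q)(Φ_∞ ⊗ f) = A Φ_∞ ⊗ Q_f f`, `ω(q⁻¹)(Φ_∞ ⊗ f) = A⁻¹ Φ_∞ ⊗ Q_f⁻¹ f` (`hq`, `hq'`) — exactly the output shape of ★
`GelbartRogawski1991.FiniteAdelicRationalImplementer.exists_arch_tmul` (Weil's rational lifts `r_F(γ)` given local implementers) and of ★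
`Automorphic.exists_continuousLinearEquiv_eq_adelicTensorEnd_of_covariant`.

RESULTS (all [folklore] bookkeeping on ★ `AdelicMetaplecticFinRep`).
* §1 **`archVec_fixed_conj`** — the conjugated splitting `s^q := (MulAut.conj q) ∘ s`, `h ↦ q · s(h) · q⁻¹`, again fixes the archimedean
  vectors, for ANY `q ∈ Mp_ψ(W_T)ᶜᵒⁿᵗ` (the `harch` transport; ★ `map_archVec_pair`: an `𝔸_F`-linear map of `W_𝔸` commutes with the
  archimedean idempotent `(1_∞, 0_f)`, so `π(q)^{±1}` permutes archimedean pairs).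
* §2 **`finRepMp_conj_apply`** — `finRepMp (s^q) h f = Q_f (finRepMp s h (Q_f⁻¹ f))` (★ `finRepMp_unique` against `Φ₀ = unitSchwartz`:
  `ω(q s(h) q⁻¹)(Φ₀ ⊗ f) = ω(q) ω(s h) ω(q⁻¹) (Φ₀ ⊗ f) = A A⁻¹ Φ₀ ⊗ Q_f ω_f(s h) Q_f⁻¹ f`, ★ `omega_map_tmul_finRepMp` in the middle);
  **`finRepMp_conj`** — `finRepMp (s^q) h = Q_f.conj (finRepMp s h)`; **`finRepMp_conj_intertwines`** — `Q_f` INTERTWINES `finRepMp s` with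
  `finRepMp (s^q)`; `finRepMp_conj_apply_clE` — the same with `A` a topological automorphism (the literal ★ `exists_arch_tmul` shape).

USE (node (T) of the census): with `q = r_F(h₀)` Weil's rational lift of the frame comparison `h₀ = Res(M ⊗ 1)` and `(A, Q_f)` from ★
`exists_arch_tmul`, §2 moves the finite Weil representation of the χ-splitting at one frame to the conjugated splitting at the other; the
χ-rigidity `(T4)` (which identifies the conjugated splitting) is NOT touched here.

## References
* [Weil1964] A. Weil, *Sur certains groupes d'opérateurs unitaires*, Acta Math. 111 (1964), Chap. III n° 37–38 pp. 188–189, n° 40 pp. 190–191.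
* [GelbartRogawski1991] S. Gelbart, J. Rogawski, Invent. Math. 105 (1991), §3.1 Prop. 3.1.1 pp. 454–455.
* [MoeglinVignerasWaldspurger1987] C. Mœglin, M.-F. Vignéras, J.-L. Waldspurger, LNM 1291 (1987), Chap. 2 II.1.
-/

set_option autoImplicit false

noncomputable section

open scoped TensorProduct Classical
open NumberField NumberField.mixedEmbedding IsDedekindDomain
open Literature.NumberTheory.Automorphic Literature.RepresentationTheory.HeisenbergGroup

namespace Literature.NumberTheory.Weil1964

variable {F : Type} [Field F] [NumberField F] {ι : Type} [Fintype ι] [DecidableEq ι]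

/-! ### §1 The `harch` transport for conjugated splittings -/

/-- plumbing (generic, to keep every step away from `rw` over the heavy adelic types): a group homomorphism on `r p r⁻¹`.
[cite: Weil1964, Chap. III n° 40 pp. 190–191] -/
private theorem map_mul_mul_inv {G G' : Type*} [Group G] [Group G'] (f : G →* G') (r p : G) :
    f (r * p * r⁻¹) = f r * f p * (f r)⁻¹ := by
  simp only [map_mul, map_inv]

/-- plumbing: a monoid-valued homomorphism on `r p r⁻¹`. [cite: Weil1964, Chap. III n° 40 pp. 190–191] -/
private theorem map_mul_mul_inv' {G M : Type*} [Group G] [Monoid M] (f : G →* M) (r p : G) :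
    f (r * p * r⁻¹) = f r * f p * f r⁻¹ := by
  simp only [map_mul]

/-- plumbing: `G⁻¹ v = u`, `K u = u` ⇒ `G (K (G⁻¹ v)) = v`. [cite: Weil1964, Chap. III n° 40 pp. 190–191] -/
private theorem apply_apply_symm_eq_of_fixed {R V : Type*} [Semiring R] [AddCommMonoid V] [Module R V] (G K : V ≃ₗ[R] V)
    (v u : V) (hu : G.symm v = u) (hK : K u = u) : G (K (G.symm v)) = v := by
  rw [hu, hK, ← hu, LinearEquiv.apply_symm_apply]

/-- plumbing: `(a b a⁻¹) v = a (b (a⁻¹ v))` for elements of a subgroup of linear automorphisms. [cite: Weil1964, Chap. III n° 40 pp. 190–191] -/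
private theorem coe_conj_apply {R V : Type*} [Semiring R] [AddCommMonoid V] [Module R V] (S : Subgroup (V ≃ₗ[R] V))
    (a b : S) (v : V) :
    ((a * b * a⁻¹ : S) : V ≃ₗ[R] V) v = (a : V ≃ₗ[R] V) ((b : V ≃ₗ[R] V) ((a : V ≃ₗ[R] V).symm v)) := rfl

variable {T : Matrix ι ι (AdeleRing (𝓞 F) F)} {H : Type*} [Monoid H]

/-- **The `harch` transport for conjugated splittings**: if the symplectic components of `s` fix the archimedean vectors, so do those
of `s^q : h ↦ q · s(h) · q⁻¹` for ANY `q ∈ Mp_ψ(W_T)ᶜᵒⁿᵗ` — `π(q)⁻¹` maps an archimedean pair to an archimedean pair (★ `map_archVec_pair`: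
an `𝔸_F`-linear map commutes with the idempotent `(1_∞, 0_f)`), which `π(s h)` fixes, and `π(q)` maps it back.  NO hypothesis on `q`.
[cite: Weil1964, Chap. III n° 40 pp. 190–191] [cite: GelbartRogawski1991, §3.1 p. 454] -/
theorem archVec_fixed_conj (s : H →* adelicMpCont F ι T)
    (harch : ∀ (h : H) (a w : ι → mixedSpace F),
      (adelicMpCont.proj F ι T (s h)).1 (archVec F ι a, archVec F ι w) = (archVec F ι a, archVec F ι w))
    (q : adelicMpCont F ι T) (h : H) (a w : ι → mixedSpace F) :
    (adelicMpCont.proj F ι T (((MulAut.conj q).toMonoidHom.comp s) h)).1 (archVec F ι a, archVec F ι w) =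
      (archVec F ι a, archVec F ι w) := by
  have hc : ((MulAut.conj q).toMonoidHom.comp s) h = q * s h * q⁻¹ := rfl
  rw [hc]
  refine (congrArg (fun g : symplecticGroup (polar (adelicForm F ι T)) =>
    (g : ((ι → AdeleRing (𝓞 F) F) × (ι → AdeleRing (𝓞 F) F)) ≃ₗ[AdeleRing (𝓞 F) F]
      ((ι → AdeleRing (𝓞 F) F) × (ι → AdeleRing (𝓞 F) F))) (archVec F ι a, archVec F ι w))
    (map_mul_mul_inv (adelicMpCont.proj F ι T) q (s h))).trans ?_
  refine (coe_conj_apply _ _ _ _).trans ?_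
  -- `π(q)⁻¹ (archVec a, archVec w)` is an archimedean pair, fixed by `π(s h)`
  have hu := map_archVec_pair
    (((adelicMpCont.proj F ι T q).1.symm :
      ((ι → AdeleRing (𝓞 F) F) × (ι → AdeleRing (𝓞 F) F)) ≃ₗ[AdeleRing (𝓞 F) F]
        ((ι → AdeleRing (𝓞 F) F) × (ι → AdeleRing (𝓞 F) F))) :
      ((ι → AdeleRing (𝓞 F) F) × (ι → AdeleRing (𝓞 F) F)) →ₗ[AdeleRing (𝓞 F) F]
        ((ι → AdeleRing (𝓞 F) F) × (ι → AdeleRing (𝓞 F) F))) a w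
  rw [LinearEquiv.coe_coe] at hu
  exact apply_apply_symm_eq_of_fixed _ _ _ _ hu (harch h _ _)

/-! ### §2 The finite factor of the conjugated splitting -/

omit [DecidableEq ι] in
/-- the archimedean test vector `unitSchwartz` is non-zero (its value at `0` is `1`). [cite: Weil1964, Chap. III n° 37 p. 188] -/
theorem unitSchwartz_ne_zero' : unitSchwartz F ι ≠ 0 := fun h0 => by
  have h1 := unitSchwartz_apply_zero (F := F) (ι := ι)
  rw [h0] at h1
  exact zero_ne_one h1

section Conj

variable (hT : IsUnit T) (s : H →* adelicMpCont F ι T)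
  (harch : ∀ (h : H) (a w : ι → mixedSpace F),
    (adelicMpCont.proj F ι T (s h)).1 (archVec F ι a, archVec F ι w) = (archVec F ι a, archVec F ι w))
  (q : adelicMpCont F ι T)
  (harch' : ∀ (h : H) (a w : ι → mixedSpace F),
    (adelicMpCont.proj F ι T (((MulAut.conj q).toMonoidHom.comp s) h)).1 (archVec F ι a, archVec F ι w) =
      (archVec F ι a, archVec F ι w))
  {A : SchwartzMap (ι → mixedSpace F) ℂ ≃ₗ[ℂ] SchwartzMap (ι → mixedSpace F) ℂ} {Qf : FinSB F ι ≃ₗ[ℂ] FinSB F ι}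
  (hq : ∀ (Φinf : SchwartzMap (ι → mixedSpace F) ℂ) (f : FinSB F ι),
    adelicMpCont.omega F ι T q (piSchwartzBruhatEquiv F ι (Φinf ⊗ₜ f)) = piSchwartzBruhatEquiv F ι (A Φinf ⊗ₜ Qf f))
  (hq' : ∀ (Φinf : SchwartzMap (ι → mixedSpace F) ℂ) (f : FinSB F ι),
    adelicMpCont.omega F ι T q⁻¹ (piSchwartzBruhatEquiv F ι (Φinf ⊗ₜ f)) =
      piSchwartzBruhatEquiv F ι (A.symm Φinf ⊗ₜ Qf.symm f))

include hq hq'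

/-- **`finRepMp (s^q) h f = Q_f (finRepMp s h (Q_f⁻¹ f))`** — the finite factor of the conjugated splitting `h ↦ q s(h) q⁻¹` is the
finite factor conjugated by the finite leg `Q_f` of `ω(q) = A ⊗ Q_f`.  Proof: ★ `finRepMp_unique` against `Φ₀ = unitSchwartz ≠ 0`;
`ω(q s(h) q⁻¹) = ω(q) ω(s h) ω(q⁻¹)` and the three operators act on pure tensors by `hq'`, ★ `omega_map_tmul_finRepMp`, `hq`, the
archimedean legs cancelling (`A A⁻¹ Φ₀ = Φ₀`).  (Any admissible `harch′` gives the same operator; the canonical one is `archVec_fixed_conj`.)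
[cite: Weil1964, Chap. III n° 38 pp. 188–189] [cite: GelbartRogawski1991, §3.1 Prop. 3.1.1 p. 455] -/
theorem finRepMp_conj_apply (h : H) (f : FinSB F ι) :
    finRepMp hT ((MulAut.conj q).toMonoidHom.comp s) harch' h f = Qf (finRepMp hT s harch h (Qf.symm f)) := by
  have key : ((Qf : FinSB F ι →ₗ[ℂ] FinSB F ι) ∘ₗ finRepMp hT s harch h ∘ₗ (Qf.symm : FinSB F ι →ₗ[ℂ] FinSB F ι)) =
      finRepMp hT ((MulAut.conj q).toMonoidHom.comp s) harch' h := by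
    refine finRepMp_unique hT _ harch' h (unitSchwartz_ne_zero' (F := F) (ι := ι)) fun g => ?_
    have hc : ((MulAut.conj q).toMonoidHom.comp s) h = q * s h * q⁻¹ := rfl
    rw [hc]
    -- `ω(q s(h) q⁻¹) = ω(q) ω(s h) ω(q⁻¹)`, applied
    refine (congrArg (fun X : Module.End ℂ (piSchwartzBruhat F ι) =>
      X (piSchwartzBruhatEquiv F ι (unitSchwartz F ι ⊗ₜ[ℂ] g)))
      (map_mul_mul_inv' (adelicMpCont.omega F ι T) q (s h))).trans ?_
    refine (Module.End.mul_apply _ _ _).trans ?_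
    refine (Module.End.mul_apply _ _ _).trans ?_
    refine (congrArg (fun Ψ => adelicMpCont.omega F ι T q (adelicMpCont.omega F ι T (s h) Ψ)) (hq' _ g)).trans ?_
    refine (congrArg (adelicMpCont.omega F ι T q) (omega_map_tmul_finRepMp hT s harch h _ _)).trans ?_
    refine (hq _ _).trans ?_
    exact congrArg (fun φ => piSchwartzBruhatEquiv F ι (φ ⊗ₜ[ℂ] Qf (finRepMp hT s harch h (Qf.symm g))))
      (A.apply_symm_apply (unitSchwartz F ι))
  exact (LinearMap.congr_fun key f).symm

/-- **`finRepMp (s^q) h = Q_f.conj (finRepMp s h)`** (`LinearEquiv.conj`: `Q_f ∘ ω_f(s h) ∘ Q_f⁻¹`).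
[cite: Weil1964, Chap. III n° 38 pp. 188–189] [cite: GelbartRogawski1991, §3.1 Prop. 3.1.1 p. 455] -/
theorem finRepMp_conj (h : H) :
    finRepMp hT ((MulAut.conj q).toMonoidHom.comp s) harch' h = Qf.conj (finRepMp hT s harch h) := by
  refine Eq.trans ?_ (LinearEquiv.conj_apply _ _).symm
  exact LinearMap.ext fun f => (finRepMp_conj_apply hT s harch q harch' hq hq' h f).trans rfl

/-- **`Q_f` intertwines**: `Q_f (finRepMp s h f) = finRepMp (s^q) h (Q_f f)`.
[cite: Weil1964, Chap. III n° 38 pp. 188–189] [cite: MoeglinVignerasWaldspurger1987, Chap. 2 II.1] -/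
theorem finRepMp_conj_intertwines (h : H) (f : FinSB F ι) :
    Qf (finRepMp hT s harch h f) = finRepMp hT ((MulAut.conj q).toMonoidHom.comp s) harch' h (Qf f) := by
  refine ((finRepMp_conj_apply hT s harch q harch' hq hq' h (Qf f)).trans ?_).symm
  exact congrArg (fun x => Qf (finRepMp hT s harch h x)) (Qf.symm_apply_apply f)

end Conj

/-- **the canonical instance, in the literal ★ `exists_arch_tmul` shape** (`A` a TOPOLOGICAL automorphism of `𝓢((F ⊗ ℝ)^ι)`,
`harch′ := archVec_fixed_conj s harch q`): `finRepMp (s^q) h f = Q_f (finRepMp s h (Q_f⁻¹ f))`.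
[cite: Weil1964, Chap. III n° 38 pp. 188–189] [cite: GelbartRogawski1991, §3.1 Prop. 3.1.1 p. 455] -/
theorem finRepMp_conj_apply_clE (hT : IsUnit T) (s : H →* adelicMpCont F ι T)
    (harch : ∀ (h : H) (a w : ι → mixedSpace F),
      (adelicMpCont.proj F ι T (s h)).1 (archVec F ι a, archVec F ι w) = (archVec F ι a, archVec F ι w))
    (q : adelicMpCont F ι T)
    (A : SchwartzMap (ι → mixedSpace F) ℂ ≃L[ℂ] SchwartzMap (ι → mixedSpace F) ℂ) (Qf : FinSB F ι ≃ₗ[ℂ] FinSB F ι)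
    (hq : ∀ (Φinf : SchwartzMap (ι → mixedSpace F) ℂ) (f : FinSB F ι),
      adelicMpCont.omega F ι T q (piSchwartzBruhatEquiv F ι (Φinf ⊗ₜ f)) = piSchwartzBruhatEquiv F ι (A Φinf ⊗ₜ Qf f))
    (hq' : ∀ (Φinf : SchwartzMap (ι → mixedSpace F) ℂ) (f : FinSB F ι),
      adelicMpCont.omega F ι T q⁻¹ (piSchwartzBruhatEquiv F ι (Φinf ⊗ₜ f)) =
        piSchwartzBruhatEquiv F ι (A.symm Φinf ⊗ₜ Qf.symm f))
    (h : H) (f : FinSB F ι) :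
    finRepMp hT ((MulAut.conj q).toMonoidHom.comp s) (archVec_fixed_conj s harch q) h f =
      Qf (finRepMp hT s harch h (Qf.symm f)) :=
  finRepMp_conj_apply hT s harch q _ (A := A.toLinearEquiv) (Qf := Qf) (fun Φinf f => hq Φinf f)
    (fun Φinf f => hq' Φinf f) h f

end Literature.NumberTheory.Weil1964

end
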